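import Summits.FinalStateConjecture.FinalStateConjecture.Theorems.EIHFluxBalanceInertialRecessionStubHigherOrderHoleFrame
import Summits.FinalStateConjecture.FinalStateConjecture.Theorems.EIHFluxBalanceInertialRecessionStubHigherOrderBodyRates

/-!
# Route EIHFluxBalance — `InertialRecession` (E′), line `SketchCleanExcision`, skeleton r13,
# stub `stub_higherOrderSlaving` (EF): the per-hole CORE bounds — frame, inverse frame, body rates,
# re-centred path and mismatch in terms of the visible jets

Helper file for the crux `stmt-FinalStateConjecture-17403`
(`Summit.FinalStateConjecture.FinalStateConjecture.Theses.EIHFluxBalance.InertialRecession`, E′),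
registered stub `stub_higherOrderSlaving` (orders two and three of frozen-vacuum slaving).

For one painted hole (smooth `Λ`, `ξ`, spin `a`, Lorentz factor `≤ γ`) and a representative frame
`Λ̃` (same `e₀` column, same `e₃` column if `a ≠ 0`, derivative bounds as in
`…StubHigherOrderHoleFrame`), `higherOrder_holeCore` bounds at every base time `t`, with ONE
constant `B`, the frame, the inverse frame `S = Λ̃⁻¹`, the body rate `A = S′Λ̃` and its derivative,
the re-centred path `c̃` and the velocity mismatch `μ = ξ′ − ũ/u⁰` by the VISIBLE sizes
`E_k = ‖u⁽ᵏ⁾‖ + ‖μ⁽ᵏ⁻¹⁾‖ + 𝟙[a ≠ 0]‖n⁽ᵏ⁾‖` (`u = Λe₀`, `n = Λe₃`), and records the converse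
pieces of the dictionary (`‖μ′‖`, `‖μ″‖` through `(S(−c̃″))~`, `(S(−c̃‴))~`; `‖u″‖`, `‖u‴‖`, `‖n″‖`,
`‖n‴‖` through `A′e`, `A″e` by the body-rate identities of `…StubHigherOrderBodyRates`). The
package `…StubHigherOrderHolePackage` turns these into the inputs of the variation bounds.

No definitions, no named facts, no `sorry`.
-/

set_option linter.dupNamespace false
set_option maxSynthPendingDepth 6
set_option synthInstance.maxHeartbeats 200000

noncomputable section

namespace Summit.FinalStateConjecture.FinalStateConjecture.Theorems.SublinearIsFree.Slaving

open scoped Topology ContDiff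
open Filter Set Function Metric Literature.Geometry.Lorentzian
  Summit.FinalStateConjecture.FinalStateConjecture.Theorems

set_option maxHeartbeats 6400000 in
/-- **The per-hole core bounds** (see the module docstring; `Λ'` is any representative frame with
the listed properties, e.g. the one of `higherOrder_exists_holeFrame`). [folklore] -/
theorem higherOrder_holeCore (Λ Λ' : ℝ → lorentzGroup) (ξ : ℝ → E3) (a : ℝ) {γ K : ℝ}
    (hΛ : ContDiff ℝ ∞ (fun t ↦ ((Λ t : E4 ≃L[ℝ] E4) : E4 →L[ℝ] E4))) (hξ : ContDiff ℝ ∞ ξ)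
    (hγ : ∀ t, |((Λ t : E4 ≃L[ℝ] E4) (E4.basisVector 0)) 0| ≤ γ)
    (hΛ's : ContDiff ℝ ∞ (fun t ↦ ((Λ' t : E4 ≃L[ℝ] E4) : E4 →L[ℝ] E4)))
    (hpaint : ∀ t c M z, boostedKerrBilin (Λ' t) c M a z = boostedKerrBilin (Λ t) c M a z)
    (hcol : ∀ t, (Λ' t : E4 ≃L[ℝ] E4) (E4.basisVector 0) = (Λ t : E4 ≃L[ℝ] E4) (E4.basisVector 0))
    (hcol3 : a ≠ 0 → ∀ t, (Λ' t : E4 ≃L[ℝ] E4) (E4.basisVector 3) = (Λ t : E4 ≃L[ℝ] E4) (E4.basisVector 3))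
    (hγ' : ∀ t, |((Λ' t : E4 ≃L[ℝ] E4) (E4.basisVector 0)) 0| ≤ γ)
    (hbd : ∀ t, ‖iteratedDeriv 1 (fun s ↦ ((Λ' s : E4 ≃L[ℝ] E4) : E4 →L[ℝ] E4)) t‖ ≤
          K * (‖iteratedDeriv 1 (fun s ↦ (Λ s : E4 ≃L[ℝ] E4) (E4.basisVector 0)) t‖ +
            (if a = 0 then 0 else ‖iteratedDeriv 1 (fun s ↦ (Λ s : E4 ≃L[ℝ] E4) (E4.basisVector 3)) t‖)) ∧
        ‖iteratedDeriv 2 (fun s ↦ ((Λ' s : E4 ≃L[ℝ] E4) : E4 →L[ℝ] E4)) t‖ ≤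
          K * ((‖iteratedDeriv 2 (fun s ↦ (Λ s : E4 ≃L[ℝ] E4) (E4.basisVector 0)) t‖ +
            (if a = 0 then 0 else ‖iteratedDeriv 2 (fun s ↦ (Λ s : E4 ≃L[ℝ] E4) (E4.basisVector 3)) t‖)) +
            (‖iteratedDeriv 1 (fun s ↦ (Λ s : E4 ≃L[ℝ] E4) (E4.basisVector 0)) t‖ +
            (if a = 0 then 0 else ‖iteratedDeriv 1 (fun s ↦ (Λ s : E4 ≃L[ℝ] E4) (E4.basisVector 3)) t‖)) ^ 2) ∧
        ‖iteratedDeriv 3 (fun s ↦ ((Λ' s : E4 ≃L[ℝ] E4) : E4 →L[ℝ] E4)) t‖ ≤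
          K * ((‖iteratedDeriv 3 (fun s ↦ (Λ s : E4 ≃L[ℝ] E4) (E4.basisVector 0)) t‖ +
            (if a = 0 then 0 else ‖iteratedDeriv 3 (fun s ↦ (Λ s : E4 ≃L[ℝ] E4) (E4.basisVector 3)) t‖)) +
            (‖iteratedDeriv 2 (fun s ↦ (Λ s : E4 ≃L[ℝ] E4) (E4.basisVector 0)) t‖ +
            (if a = 0 then 0 else ‖iteratedDeriv 2 (fun s ↦ (Λ s : E4 ≃L[ℝ] E4) (E4.basisVector 3)) t‖)) *
            (‖iteratedDeriv 1 (fun s ↦ (Λ s : E4 ≃L[ℝ] E4) (E4.basisVector 0)) t‖ +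
            (if a = 0 then 0 else ‖iteratedDeriv 1 (fun s ↦ (Λ s : E4 ≃L[ℝ] E4) (E4.basisVector 3)) t‖)) +
            (‖iteratedDeriv 1 (fun s ↦ (Λ s : E4 ≃L[ℝ] E4) (E4.basisVector 0)) t‖ +
            (if a = 0 then 0 else ‖iteratedDeriv 1 (fun s ↦ (Λ s : E4 ≃L[ℝ] E4) (E4.basisVector 3)) t‖)) ^ 3)) :
    ∃ B : ℝ, 1 ≤ B ∧ ∀ t : ℝ,
        let F : ℝ → E4 →L[ℝ] E4 := fun s ↦ ((Λ' s : E4 ≃L[ℝ] E4) : E4 →L[ℝ] E4)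
        let S : ℝ → E4 →L[ℝ] E4 := fun s ↦ (((Λ' s : E4 ≃L[ℝ] E4).symm : E4 ≃L[ℝ] E4) : E4 →L[ℝ] E4)
        let A : ℝ → E4 →L[ℝ] E4 := fun s ↦ (deriv S s).comp (F s)
        let u : ℝ → E4 := fun s ↦ (Λ s : E4 ≃L[ℝ] E4) (E4.basisVector 0)
        let n : ℝ → E4 := fun s ↦ (Λ s : E4 ≃L[ℝ] E4) (E4.basisVector 3)
        let μ : ℝ → E3 := fun s ↦ deriv ξ s - ((u s) 0)⁻¹ • E4.spatial (u s)
        let cc : ℝ → E4 := fun s ↦ E4.ofTimeSpace s (ξ s) - ((s - t) * (u t 0)⁻¹) • u s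
        let E₁ : ℝ := ‖deriv u t‖ + ‖μ t‖ + (if a = 0 then 0 else ‖deriv n t‖)
        let E₂ : ℝ := ‖iteratedDeriv 2 u t‖ + ‖deriv μ t‖ + (if a = 0 then 0 else ‖iteratedDeriv 2 n t‖)
        let E₃ : ℝ := ‖iteratedDeriv 3 u t‖ + ‖iteratedDeriv 2 μ t‖ +
          (if a = 0 then 0 else ‖iteratedDeriv 3 n t‖)
        ‖F t‖ ≤ B ∧ ‖S t‖ ≤ B ∧
        ‖deriv S t‖ ≤ B ^ 2 * E₁ ∧ (E₁ ≤ 1 → ‖iteratedDeriv 2 S t‖ ≤ 2 * B ^ 3 * (E₂ + E₁)) ∧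
        (E₁ ≤ 1 → E₂ ≤ 1 → ‖iteratedDeriv 3 S t‖ ≤ 5 * B ^ 4 * (E₃ + E₂ + E₁)) ∧
        ‖A t‖ ≤ B ^ 3 * E₁ ∧ (E₁ ≤ 1 → ‖deriv A t‖ ≤ 3 * B ^ 4 * (E₂ + E₁)) ∧
        (ContDiff ℝ ∞ cc ∧ cc t = E4.ofTimeSpace t (ξ t) ∧ deriv cc t = E4.spaceEmbed (μ t) ∧
          ∀ (M s : ℝ) (z : E4), boostedKerrBilin (Λ s) (E4.ofTimeSpace s (ξ s)) M a z =
            boostedKerrBilin (Λ' s) (cc s) M a z) ∧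
        ‖deriv cc t‖ ≤ E₁ ∧ ‖iteratedDeriv 2 cc t‖ ≤ ‖deriv μ t‖ + B * E₁ + 2 * E₁ ∧
        ‖iteratedDeriv 3 cc t‖ ≤ ‖iteratedDeriv 2 μ t‖ + B * (E₂ + E₁ ^ 2) + 3 * E₂ ∧
        ‖deriv μ t‖ ≤ ‖E4.spatial (S t (-(iteratedDeriv 2 cc t)))‖ + 2 * (B * E₁) + B * E₁ ∧
        (E₁ ≤ 1 → ‖iteratedDeriv 2 μ t‖ ≤ ‖E4.spatial (S t (-(iteratedDeriv 3 cc t)))‖ + 3 * (B * E₂) + B * (E₂ + E₁)) ∧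
        (‖iteratedDeriv 2 u t‖ ≤ B * (‖deriv A t (E4.basisVector 0)‖ + ‖A t‖ ^ 2) ∧
          ‖iteratedDeriv 3 u t‖ ≤ B * (‖iteratedDeriv 2 A t (E4.basisVector 0)‖ + 3 * ‖deriv A t‖ * ‖A t‖ + ‖A t‖ ^ 3)) ∧
        (a ≠ 0 → ‖iteratedDeriv 2 n t‖ ≤ B * (‖deriv A t (E4.basisVector 3)‖ + ‖A t‖ ^ 2) ∧
          ‖iteratedDeriv 3 n t‖ ≤ B * (‖iteratedDeriv 2 A t (E4.basisVector 3)‖ + 3 * ‖deriv A t‖ * ‖A t‖ + ‖A t‖ ^ 3)) := by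
  obtain ⟨Ci, hCi0, hinv⟩ := higherOrder_exists_inversePath_bounds γ
  obtain ⟨Kv, hKv0, hvel⟩ := higherOrder_labVelocity_bounds γ
  set B : ℝ := max (max K Ci) (max Kv 1) with hBdef
  have hB1 : 1 ≤ B := le_max_of_le_right (le_max_right _ _)
  have hB0 : 0 ≤ B := zero_le_one.trans hB1
  have hKB : K ≤ B := le_max_of_le_left (le_max_left _ _)
  have hCB : Ci ≤ B := le_max_of_le_left (le_max_right _ _)
  have hKvB : Kv ≤ B := le_max_of_le_right (le_max_left _ _)
  refine ⟨B, hB1, fun t ↦ ?_⟩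
  intro F S A u n μ cc E₁ E₂ E₃
  -- the `4`-velocity: same column for `Λ` and `Λ'`; unit timelike with Lorentz factor `≤ γ`
  have hus : ContDiff ℝ ∞ u := hΛ.clm_apply contDiff_const
  have hucol : (fun s ↦ (Λ' s : E4 ≃L[ℝ] E4) (E4.basisVector 0)) = u := funext hcol
  have hunit : ∀ s, Minkowski.bilin (u s) (u s) = -1 := fun s ↦ by
    show Minkowski.bilin ((Λ s : E4 ≃L[ℝ] E4) (E4.basisVector 0)) ((Λ s : E4 ≃L[ℝ] E4) (E4.basisVector 0)) = -1
    rw [(Λ s).2, Minkowski.bilin_basisVector_zero]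
  have hu0 : ∀ s, |u s 0| ≤ γ := hγ
  have hκ : |(u t 0)⁻¹| ≤ 1 := by
    rw [abs_inv]; exact inv_le_one_of_one_le₀ (one_le_abs_lorentz_apply_zero (Λ t))
  obtain ⟨hvs, hvb⟩ := hvel u hus hunit hu0
  set v : ℝ → E3 := fun s ↦ ((u s) 0)⁻¹ • E4.spatial (u s) with hvdef
  -- visible sizes dominate the frame quantities
  have hE₁0 : 0 ≤ E₁ := by positivity
  have hE₂0 : 0 ≤ E₂ := by positivity
  have hE₃0 : 0 ≤ E₃ := by positivity
  have hind0 : ∀ r : ℝ, 0 ≤ r → 0 ≤ (if a = 0 then 0 else r) := fun r hr ↦ by split_ifs <;> linarith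
  have hi₁ := hind0 _ (norm_nonneg (deriv n t))
  have hi₂ := hind0 _ (norm_nonneg (iteratedDeriv 2 n t))
  have hi₃ := hind0 _ (norm_nonneg (iteratedDeriv 3 n t))
  have hnu₁ := norm_nonneg (deriv u t)
  have hnu₂ := norm_nonneg (iteratedDeriv 2 u t)
  have hnu₃ := norm_nonneg (iteratedDeriv 3 u t)
  have hnμ₀ := norm_nonneg (μ t)
  have hnμ₁ := norm_nonneg (deriv μ t)
  have hnμ₂ := norm_nonneg (iteratedDeriv 2 μ t)
  have he₁ : ‖iteratedDeriv 1 u t‖ + (if a = 0 then 0 else ‖iteratedDeriv 1 n t‖) ≤ E₁ := by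
    show _ ≤ ‖deriv u t‖ + ‖μ t‖ + (if a = 0 then 0 else ‖deriv n t‖)
    simp only [iteratedDeriv_one]; linarith only [hnμ₀]
  have he₂ : ‖iteratedDeriv 2 u t‖ + (if a = 0 then 0 else ‖iteratedDeriv 2 n t‖) ≤ E₂ := by
    show _ ≤ ‖iteratedDeriv 2 u t‖ + ‖deriv μ t‖ + (if a = 0 then 0 else ‖iteratedDeriv 2 n t‖); linarith only [hnμ₁]
  have he₃ : ‖iteratedDeriv 3 u t‖ + (if a = 0 then 0 else ‖iteratedDeriv 3 n t‖) ≤ E₃ := by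
    show _ ≤ ‖iteratedDeriv 3 u t‖ + ‖iteratedDeriv 2 μ t‖ + (if a = 0 then 0 else ‖iteratedDeriv 3 n t‖)
    linarith only [hnμ₂]
  have hu₁E : ‖deriv u t‖ ≤ E₁ := by
    show _ ≤ ‖deriv u t‖ + ‖μ t‖ + (if a = 0 then 0 else ‖deriv n t‖); linarith only [hnμ₀, hi₁]
  have hu₂E : ‖iteratedDeriv 2 u t‖ ≤ E₂ := by
    show _ ≤ ‖iteratedDeriv 2 u t‖ + ‖deriv μ t‖ + (if a = 0 then 0 else ‖iteratedDeriv 2 n t‖); linarith only [hnμ₁, hi₂]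
  have hμ₀E : ‖μ t‖ ≤ E₁ := by
    show _ ≤ ‖deriv u t‖ + ‖μ t‖ + (if a = 0 then 0 else ‖deriv n t‖); linarith only [hnu₁, hi₁]
  have hμ₁E : ‖deriv μ t‖ ≤ E₂ := by
    show _ ≤ ‖iteratedDeriv 2 u t‖ + ‖deriv μ t‖ + (if a = 0 then 0 else ‖iteratedDeriv 2 n t‖); linarith only [hnu₂, hi₂]
  have hμ₂E : ‖iteratedDeriv 2 μ t‖ ≤ E₃ := by
    show _ ≤ ‖iteratedDeriv 3 u t‖ + ‖iteratedDeriv 2 μ t‖ + (if a = 0 then 0 else ‖iteratedDeriv 3 n t‖)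
    linarith only [hnu₃, hi₃]
  -- frame derivative bounds in terms of `E_k`
  obtain ⟨hF1, hF2, hF3⟩ := hbd t
  have f₁ : ‖deriv F t‖ ≤ B * E₁ := by
    have h := hF1; rw [iteratedDeriv_one] at h
    exact h.trans (mul_le_mul hKB he₁ (by positivity) hB0)
  have f₂ : E₁ ≤ 1 → ‖iteratedDeriv 2 F t‖ ≤ B * (E₂ + E₁) := fun h1 ↦ by
    refine hF2.trans (mul_le_mul hKB ?_ (by positivity) hB0)
    have hx : E₁ ^ 2 ≤ E₁ := pow_le_of_le_one hE₁0 h1 two_ne_zero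
    calc _ ≤ E₂ + E₁ ^ 2 := by gcongr
      _ ≤ E₂ + E₁ := by linarith only [hx]
  have f₃ : E₁ ≤ 1 → E₂ ≤ 1 → ‖iteratedDeriv 3 F t‖ ≤ B * (E₃ + E₂ + E₁) := fun h1 h2 ↦ by
    refine hF3.trans (mul_le_mul hKB ?_ (by positivity) hB0)
    have hx : E₂ * E₁ ≤ E₂ := mul_le_of_le_one_right hE₂0 h1
    have hy : E₁ ^ 3 ≤ E₁ := pow_le_of_le_one hE₁0 h1 (by norm_num : 3 ≠ 0)
    calc _ ≤ E₃ + E₂ * E₁ + E₁ ^ 3 := by gcongr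
      _ ≤ E₃ + E₂ + E₁ := by linarith only [hx, hy]
  -- inverse-path bounds
  obtain ⟨hFn, hSn, hS1, hS2, hS3⟩ := hinv Λ' hΛ's hγ' t
  have hFB : ‖F t‖ ≤ B := hFn.trans hCB
  have hSB : ‖S t‖ ≤ B := hSn.trans hCB
  have s₁ : ‖deriv S t‖ ≤ B ^ 2 * E₁ := by
    refine hS1.trans ?_
    calc Ci * ‖deriv F t‖ ≤ B * (B * E₁) := mul_le_mul hCB f₁ (norm_nonneg _) hB0
      _ = B ^ 2 * E₁ := by ring
  have s₂ : E₁ ≤ 1 → ‖iteratedDeriv 2 S t‖ ≤ 2 * B ^ 3 * (E₂ + E₁) := fun h1 ↦ by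
    refine hS2.trans ?_
    have hB23 : B ^ 2 ≤ B ^ 3 := pow_le_pow_right₀ hB1 (by norm_num)
    have hx : E₁ * E₁ ≤ E₂ + E₁ := by nlinarith only [hE₁0, hE₂0, h1]
    calc Ci * (‖iteratedDeriv 2 F t‖ + ‖deriv F t‖ ^ 2) ≤ B * (B * (E₂ + E₁) + (B * E₁) ^ 2) := by
          gcongr; exact f₂ h1
      _ = B ^ 2 * (E₂ + E₁) + B ^ 3 * (E₁ * E₁) := by ring
      _ ≤ B ^ 3 * (E₂ + E₁) + B ^ 3 * (E₂ + E₁) :=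
          add_le_add (mul_le_mul_of_nonneg_right hB23 (by positivity)) (mul_le_mul_of_nonneg_left hx (by positivity))
      _ = 2 * B ^ 3 * (E₂ + E₁) := by ring
  have s₃ : E₁ ≤ 1 → E₂ ≤ 1 → ‖iteratedDeriv 3 S t‖ ≤ 5 * B ^ 4 * (E₃ + E₂ + E₁) := fun h1 h2 ↦ by
    refine hS3.trans ?_
    have hf1 := f₁
    have hf2 := f₂ h1
    have hf3 := f₃ h1 h2
    have hB24 : B ^ 2 ≤ B ^ 4 := pow_le_pow_right₀ hB1 (by norm_num)
    have hB34 : B ^ 3 ≤ B ^ 4 := pow_le_pow_right₀ hB1 (by norm_num)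
    have hx : (E₂ + E₁) * E₁ ≤ E₂ + E₁ := mul_le_of_le_one_right (by positivity) h1
    have hy : E₁ ^ 3 ≤ E₁ := pow_le_of_le_one hE₁0 h1 (by norm_num)
    have hz : E₁ ≤ E₃ + E₂ + E₁ := by linarith only [hE₃0, hE₂0]
    have hw : E₂ + E₁ ≤ E₃ + E₂ + E₁ := by linarith only [hE₃0]
    calc Ci * (‖iteratedDeriv 3 F t‖ + 3 * ‖iteratedDeriv 2 F t‖ * ‖deriv F t‖ + ‖deriv F t‖ ^ 3)
        ≤ B * (B * (E₃ + E₂ + E₁) + 3 * (B * (E₂ + E₁)) * (B * E₁) + (B * E₁) ^ 3) := by gcongr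
      _ = B ^ 2 * (E₃ + E₂ + E₁) + 3 * B ^ 3 * ((E₂ + E₁) * E₁) + B ^ 4 * E₁ ^ 3 := by ring
      _ ≤ B ^ 4 * (E₃ + E₂ + E₁) + 3 * B ^ 4 * (E₃ + E₂ + E₁) + B ^ 4 * (E₃ + E₂ + E₁) := by
          refine add_le_add (add_le_add ?_ ?_) ?_
          · exact mul_le_mul_of_nonneg_right hB24 (by positivity)
          · exact mul_le_mul (mul_le_mul_of_nonneg_left hB34 (by norm_num)) (hx.trans hw) (by positivity) (by positivity)
          · exact mul_le_mul_of_nonneg_left (hy.trans hz) (by positivity)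
      _ = 5 * B ^ 4 * (E₃ + E₂ + E₁) := by ring
  -- body rates at `t`
  have hbr := higherOrder_bodyRate_identities Λ' hΛ's t
  obtain ⟨hS'eq, -, -, -, -, -, hcolid⟩ := hbr
  have hbn := higherOrder_bodyRate_norm_le Λ' hΛ's t
  obtain ⟨nA, nA', -⟩ := hbn
  -- the re-centred path (stated for `Λ'`, whose `e₀` column is `u`)
  have hcp := higherOrder_centrePath Λ' hΛ's hξ (0 : ℝ) a t
  simp only [hcol] at hcp
  obtain ⟨hccs, hcct, -, hd1, hd2, hd3⟩ := hcp
  have hcpaint : ∀ (M s : ℝ) (z : E4), boostedKerrBilin (Λ s) (E4.ofTimeSpace s (ξ s)) M a z =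
      boostedKerrBilin (Λ' s) (cc s) M a z := fun M s z ↦ by
    have h := (higherOrder_centrePath Λ' hΛ's hξ M a t).2.2.1 s z
    simp only [hcol] at h
    rw [← hpaint s _ M z, h]
  -- `ξ″ = μ′ + v′`, `ξ‴ = μ″ + v″`
  have hξ1c : ContDiff ℝ ∞ (deriv ξ) := (contDiff_infty_iff_deriv.mp hξ).2
  have hμfun : μ = fun s ↦ deriv ξ s - v s := rfl
  have hμ' : deriv μ t = iteratedDeriv 2 ξ t - deriv v t := by
    rw [hμfun, iteratedDeriv_succ, iteratedDeriv_one]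
    exact deriv_fun_sub (hξ1c.differentiable (by simp) t) (hvs.differentiable (by simp) t)
  have hμ'' : iteratedDeriv 2 μ t = iteratedDeriv 3 ξ t - iteratedDeriv 2 v t := by
    have hξ2c : ContDiff ℝ ∞ (iteratedDeriv 2 ξ) := by
      rw [iteratedDeriv_succ, iteratedDeriv_one]; exact (contDiff_infty_iff_deriv.mp hξ1c).2
    have hv1c : ContDiff ℝ ∞ (deriv v) := (contDiff_infty_iff_deriv.mp hvs).2
    have hdμ : deriv μ = fun s ↦ iteratedDeriv 2 ξ s - deriv v s := by
      funext s
      rw [hμfun, iteratedDeriv_succ, iteratedDeriv_one]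
      exact deriv_fun_sub (hξ1c.differentiable (by simp) s) (hvs.differentiable (by simp) s)
    have h3 : iteratedDeriv 3 ξ t = deriv (iteratedDeriv 2 ξ) t := by rw [iteratedDeriv_succ]
    have h2v : iteratedDeriv 2 v t = deriv (deriv v) t := by rw [iteratedDeriv_succ, iteratedDeriv_one]
    have h2μ : iteratedDeriv 2 μ t = deriv (deriv μ) t := by rw [iteratedDeriv_succ, iteratedDeriv_one]
    rw [h2μ, hdμ, h3, h2v]
    exact deriv_fun_sub (hξ2c.differentiable (by simp) t) (hv1c.differentiable (by simp) t)
  obtain ⟨hv1, hv2⟩ := hvb t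
  have hξ2 : ‖iteratedDeriv 2 ξ t‖ ≤ ‖deriv μ t‖ + B * E₁ := by
    have h : iteratedDeriv 2 ξ t = deriv μ t + deriv v t := by rw [hμ']; abel
    rw [h]
    refine (norm_add_le _ _).trans (add_le_add le_rfl (hv1.trans ?_))
    exact mul_le_mul hKvB hu₁E (norm_nonneg _) hB0
  have hξ3 : ‖iteratedDeriv 3 ξ t‖ ≤ ‖iteratedDeriv 2 μ t‖ + B * (E₂ + E₁ ^ 2) := by
    have h : iteratedDeriv 3 ξ t = iteratedDeriv 2 μ t + iteratedDeriv 2 v t := by rw [hμ'']; abel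
    rw [h]
    refine (norm_add_le _ _).trans (add_le_add le_rfl (hv2.trans ?_))
    exact mul_le_mul hKvB (by gcongr) (by positivity) hB0
  -- norms of embedded spatial vectors
  have hnemb : ∀ y : E3, ‖E4.spaceEmbed y‖ = ‖y‖ := fun y ↦ by
    rw [E4.spaceEmbed_apply, norm_eq_spatialNorm_of_apply_zero_eq_zero (E4.ofTimeSpace_apply_zero _ _),
      E4.spatialNorm, E4.spatial_ofTimeSpace]
  have hnsp : ∀ w : E4, ‖E4.spatial w‖ ≤ ‖w‖ := fun w ↦ by
    have h := norm_sq_eq_sq_add_spatialNorm_sq w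
    have h2 : ‖E4.spatial w‖ ^ 2 ≤ ‖w‖ ^ 2 := by
      rw [h]; change E4.spatialNorm w ^ 2 ≤ _; nlinarith only [sq_nonneg (w 0)]
    exact (pow_le_pow_iff_left₀ (norm_nonneg _) (norm_nonneg _) two_ne_zero).1 h2
  -- boosts stretch spatial vectors: `‖y‖ ≤ ‖(S (0,y))~‖`
  have hstretch : ∀ y : E3, ‖y‖ ≤ ‖E4.spatial (S t (E4.spaceEmbed y))‖ := fun y ↦ by
    have h := norm_le_spatialNorm_lorentz_apply (Λ' t)⁻¹ (w := E4.spaceEmbed y) (by simp)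
    rw [coe_lorentz_inv, hnemb] at h
    exact h
  -- sizes of the centre-path derivatives
  have hcc1 : ‖deriv cc t‖ ≤ E₁ := by rw [hd1, hnemb]; exact hμ₀E
  have hcc2 : ‖iteratedDeriv 2 cc t‖ ≤ ‖deriv μ t‖ + B * E₁ + 2 * E₁ := by
    rw [hd2]
    refine (norm_sub_le _ _).trans (add_le_add ((hnemb _).le.trans hξ2) ?_)
    rw [norm_smul, Real.norm_eq_abs, abs_mul, abs_two]
    calc 2 * |(u t 0)⁻¹| * ‖deriv u t‖ ≤ 2 * 1 * E₁ := by gcongr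
      _ = 2 * E₁ := by ring
  have hcc3 : ‖iteratedDeriv 3 cc t‖ ≤ ‖iteratedDeriv 2 μ t‖ + B * (E₂ + E₁ ^ 2) + 3 * E₂ := by
    rw [hd3]
    refine (norm_sub_le _ _).trans (add_le_add ((hnemb _).le.trans hξ3) ?_)
    rw [norm_smul, Real.norm_eq_abs, abs_mul, show |(3 : ℝ)| = 3 by norm_num]
    calc 3 * |(u t 0)⁻¹| * ‖iteratedDeriv 2 u t‖ ≤ 3 * 1 * E₂ := by gcongr
      _ = 3 * E₂ := by ring
  -- body-rate sizes
  have hA0 : ‖A t‖ ≤ B ^ 3 * E₁ := by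
    refine nA.trans ?_
    calc ‖deriv S t‖ * ‖F t‖ ≤ (B ^ 2 * E₁) * B := mul_le_mul s₁ hFB (norm_nonneg _) (by positivity)
      _ = B ^ 3 * E₁ := by ring
  have hA1 : E₁ ≤ 1 → ‖deriv A t‖ ≤ 3 * B ^ 4 * (E₂ + E₁) := fun h1 ↦ by
    refine nA'.trans ?_
    calc ‖iteratedDeriv 2 S t‖ * ‖F t‖ + ‖deriv S t‖ * ‖deriv F t‖
        ≤ (2 * B ^ 3 * (E₂ + E₁)) * B + (B ^ 2 * E₁) * (B * E₁) :=
          add_le_add (mul_le_mul (s₂ h1) hFB (norm_nonneg _) (by positivity))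
            (mul_le_mul s₁ f₁ (norm_nonneg _) (by positivity))
      _ = 2 * B ^ 4 * (E₂ + E₁) + B ^ 3 * (E₁ * E₁) := by ring
      _ ≤ 2 * B ^ 4 * (E₂ + E₁) + B ^ 4 * (E₂ + E₁) := by
          have hB34 : B ^ 3 ≤ B ^ 4 := pow_le_pow_right₀ hB1 (by norm_num)
          have hx : E₁ * E₁ ≤ E₂ + E₁ := by nlinarith only [hE₁0, hE₂0, h1]
          exact add_le_add le_rfl (mul_le_mul hB34 hx (by positivity) (by positivity))
      _ = 3 * B ^ 4 * (E₂ + E₁) := by ring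
  -- the spatial lower bounds through `d₂ = S(−c̃″)`, `d₃ = S(−c̃‴)`
  have hξ2low : ‖iteratedDeriv 2 ξ t‖ ≤ ‖E4.spatial (S t (-(iteratedDeriv 2 cc t)))‖ + 2 * (B * E₁) := by
    have heq : E4.spaceEmbed (iteratedDeriv 2 ξ t) = iteratedDeriv 2 cc t + (2 * (u t 0)⁻¹) • deriv u t := by
      rw [hd2]; abel
    calc ‖iteratedDeriv 2 ξ t‖ ≤ ‖E4.spatial (S t (E4.spaceEmbed (iteratedDeriv 2 ξ t)))‖ := hstretch _
      _ = ‖-E4.spatial (S t (-(iteratedDeriv 2 cc t))) + (2 * (u t 0)⁻¹) • E4.spatial (S t (deriv u t))‖ := by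
          rw [heq, map_add, map_add, map_smul, map_smul, map_neg, map_neg, neg_neg]
      _ ≤ ‖E4.spatial (S t (-(iteratedDeriv 2 cc t)))‖ + ‖(2 * (u t 0)⁻¹) • E4.spatial (S t (deriv u t))‖ := by
          refine (norm_add_le _ _).trans ?_; rw [norm_neg]
      _ ≤ ‖E4.spatial (S t (-(iteratedDeriv 2 cc t)))‖ + 2 * (B * E₁) := by
          gcongr
          rw [norm_smul, Real.norm_eq_abs, abs_mul, abs_two]
          calc 2 * |(u t 0)⁻¹| * ‖E4.spatial (S t (deriv u t))‖ ≤ 2 * 1 * (‖S t‖ * ‖deriv u t‖) := by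
                gcongr; exact (hnsp _).trans ((S t).le_opNorm _)
            _ ≤ 2 * 1 * (B * E₁) := by gcongr
            _ = 2 * (B * E₁) := by ring
  have hξ3low : ‖iteratedDeriv 3 ξ t‖ ≤ ‖E4.spatial (S t (-(iteratedDeriv 3 cc t)))‖ + 3 * (B * E₂) := by
    have heq : E4.spaceEmbed (iteratedDeriv 3 ξ t) = iteratedDeriv 3 cc t + (3 * (u t 0)⁻¹) • iteratedDeriv 2 u t := by
      rw [hd3]; abel
    calc ‖iteratedDeriv 3 ξ t‖ ≤ ‖E4.spatial (S t (E4.spaceEmbed (iteratedDeriv 3 ξ t)))‖ := hstretch _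
      _ = ‖-E4.spatial (S t (-(iteratedDeriv 3 cc t))) + (3 * (u t 0)⁻¹) • E4.spatial (S t (iteratedDeriv 2 u t))‖ := by
          rw [heq, map_add, map_add, map_smul, map_smul, map_neg, map_neg, neg_neg]
      _ ≤ ‖E4.spatial (S t (-(iteratedDeriv 3 cc t)))‖ + ‖(3 * (u t 0)⁻¹) • E4.spatial (S t (iteratedDeriv 2 u t))‖ := by
          refine (norm_add_le _ _).trans ?_; rw [norm_neg]
      _ ≤ ‖E4.spatial (S t (-(iteratedDeriv 3 cc t)))‖ + 3 * (B * E₂) := by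
          gcongr
          rw [norm_smul, Real.norm_eq_abs, abs_mul, show |(3 : ℝ)| = 3 by norm_num]
          calc 3 * |(u t 0)⁻¹| * ‖E4.spatial (S t (iteratedDeriv 2 u t))‖ ≤ 3 * 1 * (‖S t‖ * ‖iteratedDeriv 2 u t‖) := by
                gcongr; exact (hnsp _).trans ((S t).le_opNorm _)
            _ ≤ 3 * 1 * (B * E₂) := by gcongr
            _ = 3 * (B * E₂) := by ring
  -- the column identities: `S u″ = A(Ae₀) − A′e₀`, `S u‴ = A′Ae₀ + 2AA′e₀ − A³e₀ − A″e₀` (and for `e₃`)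
  have hFcol : ∀ s, F s (E4.basisVector 0) = u s := hcol
  have he0 : ‖(E4.basisVector 0 : E4)‖ = 1 := by simp
  have he3 : ‖(E4.basisVector 3 : E4)‖ = 1 := by simp
  have hcolbound : ∀ (e : E4) (w : ℝ → E4), ‖e‖ = 1 → (∀ s, F s e = w s) →
      ‖iteratedDeriv 2 w t‖ ≤ B * (‖deriv A t e‖ + ‖A t‖ ^ 2) ∧
      ‖iteratedDeriv 3 w t‖ ≤ B * (‖iteratedDeriv 2 A t e‖ + 3 * ‖deriv A t‖ * ‖A t‖ + ‖A t‖ ^ 3) := by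
    intro e w he hw
    have hwf : (fun s ↦ F s e) = w := funext hw
    obtain ⟨-, h2e, h3e⟩ := hcolid e
    rw [hwf] at h2e h3e
    have hSw2 : S t (iteratedDeriv 2 w t) = A t (A t e) - deriv A t e := by rw [h2e]; abel
    have hSw3 : S t (iteratedDeriv 3 w t) = deriv A t (A t e) + (2 : ℝ) • A t (deriv A t e) -
        A t (A t (A t e)) - iteratedDeriv 2 A t e := by rw [h3e]; abel
    have hFS : ∀ X : E4, F t (S t X) = X := fun X ↦ (Λ' t : E4 ≃L[ℝ] E4).apply_symm_apply X
    have hAe : ‖A t e‖ ≤ ‖A t‖ := by simpa [he] using (A t).le_opNorm e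
    constructor
    · calc ‖iteratedDeriv 2 w t‖ = ‖F t (S t (iteratedDeriv 2 w t))‖ := by rw [hFS]
        _ ≤ ‖F t‖ * ‖S t (iteratedDeriv 2 w t)‖ := (F t).le_opNorm _
        _ ≤ B * (‖deriv A t e‖ + ‖A t‖ ^ 2) := by
            refine mul_le_mul hFB ?_ (norm_nonneg _) hB0
            rw [hSw2]
            refine (norm_sub_le _ _).trans ?_
            rw [add_comm]
            gcongr
            calc ‖A t (A t e)‖ ≤ ‖A t‖ * ‖A t e‖ := (A t).le_opNorm _
              _ ≤ ‖A t‖ * ‖A t‖ := by gcongr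
              _ = ‖A t‖ ^ 2 := by ring
    · calc ‖iteratedDeriv 3 w t‖ = ‖F t (S t (iteratedDeriv 3 w t))‖ := by rw [hFS]
        _ ≤ ‖F t‖ * ‖S t (iteratedDeriv 3 w t)‖ := (F t).le_opNorm _
        _ ≤ B * (‖iteratedDeriv 2 A t e‖ + 3 * ‖deriv A t‖ * ‖A t‖ + ‖A t‖ ^ 3) := by
            refine mul_le_mul hFB ?_ (norm_nonneg _) hB0
            rw [hSw3]
            have h1 : ‖deriv A t (A t e)‖ ≤ ‖deriv A t‖ * ‖A t‖ :=
              ((deriv A t).le_opNorm _).trans (by gcongr)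
            have h2 : ‖(2 : ℝ) • A t (deriv A t e)‖ ≤ 2 * (‖A t‖ * ‖deriv A t‖) := by
              rw [norm_smul, Real.norm_eq_abs, abs_two]
              gcongr
              exact ((A t).le_opNorm _).trans (by gcongr; simpa [he] using (deriv A t).le_opNorm e)
            have h3 : ‖A t (A t (A t e))‖ ≤ ‖A t‖ ^ 3 := by
              calc _ ≤ ‖A t‖ * ‖A t (A t e)‖ := (A t).le_opNorm _
                _ ≤ ‖A t‖ * (‖A t‖ * ‖A t e‖) := by gcongr; exact (A t).le_opNorm _
                _ ≤ ‖A t‖ * (‖A t‖ * ‖A t‖) := by gcongr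
                _ = ‖A t‖ ^ 3 := by ring
            calc _ ≤ ‖deriv A t (A t e)‖ + ‖(2 : ℝ) • A t (deriv A t e)‖ + ‖A t (A t (A t e))‖ +
                  ‖iteratedDeriv 2 A t e‖ :=
                  (norm_sub_le _ _).trans (add_le_add ((norm_sub_le _ _).trans (add_le_add (norm_add_le _ _) le_rfl)) le_rfl)
              _ ≤ ‖deriv A t‖ * ‖A t‖ + 2 * (‖A t‖ * ‖deriv A t‖) + ‖A t‖ ^ 3 + ‖iteratedDeriv 2 A t e‖ := by
                  gcongr
              _ = _ := by ring
  obtain ⟨hu2low, hu3low⟩ := hcolbound (E4.basisVector 0) u he0 hcol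
  -- the mismatch derivatives through the spatial lower bounds
  have hμ1 : ‖deriv μ t‖ ≤ ‖E4.spatial (S t (-(iteratedDeriv 2 cc t)))‖ + 2 * (B * E₁) + B * E₁ := by
    calc ‖deriv μ t‖ = ‖iteratedDeriv 2 ξ t - deriv v t‖ := by rw [hμ']
      _ ≤ ‖iteratedDeriv 2 ξ t‖ + ‖deriv v t‖ := norm_sub_le _ _
      _ ≤ _ := add_le_add hξ2low (hv1.trans (mul_le_mul hKvB hu₁E (norm_nonneg _) hB0))
  have hμ2 : E₁ ≤ 1 → ‖iteratedDeriv 2 μ t‖ ≤ ‖E4.spatial (S t (-(iteratedDeriv 3 cc t)))‖ + 3 * (B * E₂) + B * (E₂ + E₁) := by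
    intro h1
    calc ‖iteratedDeriv 2 μ t‖ = ‖iteratedDeriv 3 ξ t - iteratedDeriv 2 v t‖ := by rw [hμ'']
      _ ≤ ‖iteratedDeriv 3 ξ t‖ + ‖iteratedDeriv 2 v t‖ := norm_sub_le _ _
      _ ≤ _ := add_le_add hξ3low (hv2.trans ?_)
    refine mul_le_mul hKvB ?_ (by positivity) hB0
    calc _ ≤ E₂ + E₁ ^ 2 := by gcongr
      _ ≤ E₂ + E₁ := by linarith only [pow_le_of_le_one hE₁0 h1 two_ne_zero]
  exact ⟨hFB, hSB, s₁, s₂, s₃, hA0, hA1, ⟨hccs, hcct, hd1, hcpaint⟩, hcc1, hcc2, hcc3, hμ1, hμ2,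
    ⟨hu2low, hu3low⟩, fun ha ↦ hcolbound (E4.basisVector 3) n he3 (hcol3 ha)⟩

/-- **Registered one-line carrier form** (`higherOrder_holeCore_EF`): the zeroth- and first-order
part of `higherOrder_holeCore`. [folklore] -/
theorem higherOrder_holeCore_EF : open Literature.Geometry.Lorentzian in ∀ (Λ Λ' : ℝ → lorentzGroup) (ξ : ℝ → E3) (a : ℝ) {γ K : ℝ}, ContDiff ℝ ((⊤ : ℕ∞) : WithTop ℕ∞) (fun t ↦ ((Λ t : E4 ≃L[ℝ] E4) : E4 →L[ℝ] E4)) → ContDiff ℝ ((⊤ : ℕ∞) : WithTop ℕ∞) ξ → (∀ t, |((Λ t : E4 ≃L[ℝ] E4) (E4.basisVector 0)) 0| ≤ γ) → ContDiff ℝ ((⊤ : ℕ∞) : WithTop ℕ∞) (fun t ↦ ((Λ' t : E4 ≃L[ℝ] E4) : E4 →L[ℝ] E4)) → (∀ t c M z, boostedKerrBilin (Λ' t) c M a z = boostedKerrBilin (Λ t) c M a z) → (∀ t, (Λ' t : E4 ≃L[ℝ] E4) (E4.basisVector 0) = (Λ t : E4 ≃L[ℝ] E4) (E4.basisVector 0))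 → (a ≠ 0 → ∀ t, (Λ' t : E4 ≃L[ℝ] E4) (E4.basisVector 3) = (Λ t : E4 ≃L[ℝ] E4) (E4.basisVector 3)) → (∀ t, |((Λ' t : E4 ≃L[ℝ] E4) (E4.basisVector 0)) 0| ≤ γ) → (∀ t, ‖iteratedDeriv 1 (fun s ↦ ((Λ' s : E4 ≃L[ℝ] E4) : E4 →L[ℝ] E4)) t‖ ≤ K * (‖iteratedDeriv 1 (fun s ↦ (Λ s : E4 ≃L[ℝ] E4) (E4.basisVector 0)) t‖ + (if a = 0 then 0 else ‖iteratedDeriv 1 (fun s ↦ (Λ s : E4 ≃L[ℝ] E4) (E4.basisVector 3)) t‖)) ∧ ‖iteratedDeriv 2 (fun s ↦ ((Λ' s : E4 ≃L[ℝ] E4) : E4 →L[ℝ] E4)) t‖ ≤ K * ((‖iteratedDeriv 2 (fun s ↦ (Λ s : E4 ≃L[ℝ] E4) (E4.basisVector 0)) t‖ + (if a = 0 then 0 else ‖iteratedDeriv 2 (fun s ↦ (Λ s : E4 ≃L[ℝ] E4) (E4.basisVector 3)) t‖)) + (‖iteratedDeriv 1 (fun s ↦ (Λ s : E4 ≃L[ℝ]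 E4) (E4.basisVector 0)) t‖ + (if a = 0 then 0 else ‖iteratedDeriv 1 (fun s ↦ (Λ s : E4 ≃L[ℝ] E4) (E4.basisVector 3)) t‖)) ^ 2) ∧ ‖iteratedDeriv 3 (fun s ↦ ((Λ' s : E4 ≃L[ℝ] E4) : E4 →L[ℝ] E4)) t‖ ≤ K * ((‖iteratedDeriv 3 (fun s ↦ (Λ s : E4 ≃L[ℝ] E4) (E4.basisVector 0)) t‖ + (if a = 0 then 0 else ‖iteratedDeriv 3 (fun s ↦ (Λ s : E4 ≃L[ℝ] E4) (E4.basisVector 3)) t‖)) + (‖iteratedDeriv 2 (fun s ↦ (Λ s : E4 ≃L[ℝ] E4) (E4.basisVector 0)) t‖ + (if a = 0 then 0 else ‖iteratedDeriv 2 (fun s ↦ (Λ s : E4 ≃L[ℝ] E4) (E4.basisVector 3)) t‖)) * (‖iteratedDeriv 1 (fun s ↦ (Λ s : E4 ≃L[ℝ] E4) (E4.basisVector 0)) t‖ + (if a = 0 then 0 else ‖iteratedDeriv 1 (fun s ↦ (Λ s : E4 ≃L[ℝ] E4) (E4.basisVector 3)) t‖)) + (‖iteratedDeriv 1 (fun s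 ↦ (Λ s : E4 ≃L[ℝ] E4) (E4.basisVector 0)) t‖ + (if a = 0 then 0 else ‖iteratedDeriv 1 (fun s ↦ (Λ s : E4 ≃L[ℝ] E4) (E4.basisVector 3)) t‖)) ^ 3)) → ∃ B : ℝ, 1 ≤ B ∧ ∀ t : ℝ, let F : ℝ → E4 →L[ℝ] E4 := fun s ↦ ((Λ' s : E4 ≃L[ℝ] E4) : E4 →L[ℝ] E4); let S : ℝ → E4 →L[ℝ] E4 := fun s ↦ (((Λ' s : E4 ≃L[ℝ] E4).symm : E4 ≃L[ℝ] E4) : E4 →L[ℝ] E4); let u : ℝ → E4 := fun s ↦ (Λ s : E4 ≃L[ℝ] E4) (E4.basisVector 0); let n : ℝ → E4 := fun s ↦ (Λ s : E4 ≃L[ℝ] E4) (E4.basisVector 3); let μ : ℝ → E3 := fun s ↦ deriv ξ s - ((u s) 0)⁻¹ • E4.spatial (u s); let E₁ : ℝ := ‖deriv u t‖ + ‖μ t‖ + (if a = 0 then 0 else ‖deriv n t‖); ‖F t‖ ≤ B ∧ ‖S t‖ ≤ B ∧ ‖deriv S t‖ ≤ B ^ 2 * E₁ ∧ ‖(deriv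 S t).comp (F t)‖ ≤ B ^ 3 * E₁ := by
  intro Λ Λ' ξ a _ _ hΛ hξ hγ hΛ's hpaint hcol hcol3 hγ' hbd
  obtain ⟨B, hB1, h⟩ := higherOrder_holeCore Λ Λ' ξ a hΛ hξ hγ hΛ's hpaint hcol hcol3 hγ' hbd
  refine ⟨B, hB1, fun t ↦ ?_⟩
  obtain ⟨h1, h2, h3, -, -, h6, -⟩ := h t
  exact ⟨h1, h2, h3, h6⟩

end Summit.FinalStateConjecture.FinalStateConjecture.Theorems.SublinearIsFree.Slaving

end
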